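import Mathlib
import Literature.AlgebraicGeometry.Resolution.CobordantGame
import Summits.ResolutionOfSingularities.ResolutionOfSingularities.Theorems.WeightedInvariantLocalWeightedDropGradedSliceRank
import Summits.ResolutionOfSingularities.ResolutionOfSingularities.Theorems.WeightedInvariantLocalWeightedDropTwistedTrivialXOrder

/-!
# `WeightedInvariant.LocalWeightedDrop`: the graded game is EQUIVARIANT UNDER RELABELLING of the coordinates («general slot»)

Route `ResolutionOfSingularities/WeightedInvariant`, crux `LocalWeightedDrop` (stmt-ResolutionOfSingularities-8899).
[OURS · L1 W4.3] — res-type-099 (gen 13), general-slot tool announced 12:04:55Z (TAKING-UNLESS-OBJECTED) for the graded-slice line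
(ideator res-L1-w43-idea-1): the slice theorems of the line — `gradedWonBy_of_slice_tame` (p515424), `gradedWonBy_wildLambdaFrob_of_slice`
/ `gradedWonBy_of_slice_wild_of_descent` (p525479), `gradedWonBy_zero_of_slice_wild` (p529887), the refutations p508918 / p523464 — are
all stated with the FROZEN COORDINATE LAST («general slot by relabelling, not done», three module docstrings).  This file supplies the
relabelling: for a permutation `π` of the coordinates, `f ↦ f^π := f(x_{π i})` and `L ↦ L^π := {v : v ∘ π ∈ L}`,
**`GradedWonBy α m L^π f^π ↔ GradedWonBy α m L f`** (`gradedWonBy_relabel_iff`).  So a minimal-valuation translated coordinate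
may be moved to the last slot before invoking the slice theorems.  Nothing here is a statement of the manuscript under review on
ladder RESOLUTION; no new mathematics (bookkeeping).  AI proof, weaker than expert review.

* §1 `relabel π f` (`coeff_relabel`: `[x^e] f^π = [x^{e∘π}] f`), §2 `liftPerm π` (fix `s`), §3 `permLattice π L`; §4 `isLGradedMove_relabel`
  (`θ^π_j = (θ_{π⁻¹ j})^π`, weights `w ∘ π⁻¹`); §5 `subst_cruxChart_relabel` (charts commute with relabelling) and the successor transport;
  §6 `succLattice_permLattice`; §7 `gradedWonBy_relabel`, `gradedWonBy_relabel_iff` (transfinite induction on the rank).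
-/

set_option linter.dupNamespace false -- mandated namespace of this single-conjunct summit
set_option autoImplicit false

namespace Summit.ResolutionOfSingularities.ResolutionOfSingularities.Theorems

namespace GradedGame

open MvPowerSeries
open Literature.AlgebraicGeometry.Resolution

variable {k : Type} [Field k]

/-! ## §1 Relabelling a series -/

section Relabel

variable {m : ℕ} (π : Equiv.Perm (Fin m))

/-- RELABELLING the coordinates: `f^π := f(x_{π 0}, …, x_{π (m-1)})`, i.e. `x_i ↦ x_{π i}`. [OURS · L1 W4.3] -/
noncomputable def relabel (f : MvPowerSeries (Fin m) k) : MvPowerSeries (Fin m) k :=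
  subst (fun i => (X (π i) : MvPowerSeries (Fin m) k)) f

/-- The relabelling family is substitutable. [OURS · L1 W4.3] -/
theorem hasSubst_relabelFamily : HasSubst (fun i => (X (π i) : MvPowerSeries (Fin m) k)) :=
  hasSubst_of_constantCoeff_zero fun _ => constantCoeff_X _

/-- The relabelling family as a monomial family. [OURS · L1 W4.3] -/
theorem relabelFamily_eq_monomial :
    (fun i => (X (π i) : MvPowerSeries (Fin m) k)) = fun i => (monomial (Finsupp.single (π i) 1) (1 : k) : MvPowerSeries (Fin m) k) := by
  funext i; rw [X_def]

/-- The image exponent of the relabelling family is `e ∘ π⁻¹`. [OURS · L1 W4.3] -/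
theorem linExp_relabel (d : Fin m →₀ ℕ) :
    linExp (fun i => Finsupp.single (π i) 1) d = Finsupp.equivMapDomain π d := by
  classical
  ext b
  rw [linExp_apply, Finsupp.sum, Finsupp.equivMapDomain_apply]
  have : ∀ v ∈ d.support, d v * (Finsupp.single (π v) 1 : Fin m →₀ ℕ) b = if v = π.symm b then d v else 0 := by
    intro v _
    rw [Finsupp.single_apply]
    by_cases hv : v = π.symm b
    · subst hv; simp
    · rw [if_neg (fun h => hv (by rw [← h]; simp)), if_neg hv, mul_zero]
  rw [Finset.sum_congr rfl this, Finset.sum_ite_eq']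
  split_ifs with h0
  · rfl
  · exact (Finsupp.notMem_support_iff.mp h0).symm

/-- **COEFFICIENTS OF A RELABELLED SERIES**: `[x^e] f^π = [x^{e ∘ π}] f` (as `equivMapDomain π⁻¹ e`). [OURS · L1 W4.3] -/
theorem coeff_relabel (f : MvPowerSeries (Fin m) k) (e : Fin m →₀ ℕ) :
    coeff e (relabel π f) = coeff (Finsupp.equivMapDomain π.symm e) f := by
  have hS := hasSubst_relabelFamily (k := k) π
  unfold relabel
  rw [relabelFamily_eq_monomial] at hS ⊢
  have hinj : Function.Injective (linExp (fun i => (Finsupp.single (π i) 1 : Fin m →₀ ℕ))) := by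
    intro d d' h
    rw [linExp_relabel, linExp_relabel] at h
    have := congrArg (Finsupp.equivMapDomain π.symm) h
    simpa [← Finsupp.equivMapDomain_trans] using this
  have he : e = linExp (fun i => (Finsupp.single (π i) 1 : Fin m →₀ ℕ)) (Finsupp.equivMapDomain π.symm e) := by
    rw [linExp_relabel, ← Finsupp.equivMapDomain_trans]; simp
  conv_lhs => rw [he]
  exact coeff_linExp_subst_monomial _ hS hinj f _

/-- Relabelling a variable. [OURS · L1 W4.3] -/
theorem relabel_X (i : Fin m) : relabel π (X i : MvPowerSeries (Fin m) k) = X (π i) := by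
  unfold relabel; rw [subst_X (hasSubst_relabelFamily π)]

/-- Relabelling twice. [OURS · L1 W4.3] -/
theorem relabel_relabel (ρ : Equiv.Perm (Fin m)) (f : MvPowerSeries (Fin m) k) :
    relabel ρ (relabel π f) = relabel (π.trans ρ) f := by
  unfold relabel
  rw [subst_comp_subst_apply (hasSubst_relabelFamily π) (hasSubst_relabelFamily ρ)]
  congr 1
  funext i
  rw [subst_X (hasSubst_relabelFamily ρ)]
  rfl

/-- Relabelling by the identity. [OURS · L1 W4.3] -/
theorem relabel_refl (f : MvPowerSeries (Fin m) k) : relabel (Equiv.refl _) f = f := by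
  unfold relabel
  rw [show (fun i => (X ((Equiv.refl (Fin m)) i) : MvPowerSeries (Fin m) k)) = X from rfl, subst_self]
  rfl

/-- Undoing a relabelling. [OURS · L1 W4.3] -/
theorem relabel_symm_relabel (f : MvPowerSeries (Fin m) k) : relabel π.symm (relabel π f) = f := by
  rw [relabel_relabel, Equiv.self_trans_symm, relabel_refl]

/-- Undoing a relabelling. [OURS · L1 W4.3] -/
theorem relabel_relabel_symm (f : MvPowerSeries (Fin m) k) : relabel π (relabel π.symm f) = f := by
  rw [relabel_relabel, Equiv.symm_trans_self, relabel_refl]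

/-- Relabelling keeps the constant term. [OURS · L1 W4.3] -/
theorem constantCoeff_relabel (f : MvPowerSeries (Fin m) k) : constantCoeff (relabel π f) = constantCoeff f := by
  rw [← coeff_zero_eq_constantCoeff_apply, ← coeff_zero_eq_constantCoeff_apply, coeff_relabel]
  simp

/-- Relabelling permutes the linear coefficients. [OURS · L1 W4.3] -/
theorem coeff_single_relabel (f : MvPowerSeries (Fin m) k) (j : Fin m) :
    coeff (Finsupp.single j 1) (relabel π f) = coeff (Finsupp.single (π.symm j) 1) f := by
  rw [coeff_relabel, Finsupp.equivMapDomain_single]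

/-- `𝔪²` is transported by relabelling. [OURS · L1 W4.3] -/
theorem singular_relabel_iff (f : MvPowerSeries (Fin m) k) :
    (constantCoeff (relabel π f) = 0 ∧ ∀ j, coeff (Finsupp.single j 1) (relabel π f) = 0) ↔
      (constantCoeff f = 0 ∧ ∀ j, coeff (Finsupp.single j 1) f = 0) := by
  rw [constantCoeff_relabel]
  refine and_congr Iff.rfl ⟨fun h j => ?_, fun h j => ?_⟩
  · have := h (π j); rwa [coeff_single_relabel, Equiv.symm_apply_apply] at this
  · rw [coeff_single_relabel]; exact h _

/-- `x_a ∣` is transported by a relabelling fixing `a`. [OURS · L1 W4.3] -/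
theorem X_dvd_relabel_iff {a : Fin m} (ha : π a = a) (f : MvPowerSeries (Fin m) k) : X a ∣ relabel π f ↔ X a ∣ f := by
  have ha' : π.symm a = a := by rw [← ha, Equiv.symm_apply_apply, ha]
  rw [X_dvd_iff, X_dvd_iff]
  constructor
  · intro h e he
    have h1 := h (Finsupp.equivMapDomain π e) (by rw [Finsupp.equivMapDomain_apply, ha']; exact he)
    rwa [coeff_relabel, ← Finsupp.equivMapDomain_trans, Equiv.self_trans_symm, Finsupp.equivMapDomain_refl] at h1
  · intro h e he
    rw [coeff_relabel]
    exact h _ (by rw [Finsupp.equivMapDomain_apply, Equiv.symm_symm, ha]; exact he)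

end Relabel

/-! ## §2 Lifting a permutation over the exceptional variable -/

section Lift

variable {m : ℕ} (π : Equiv.Perm (Fin m))

/-- The lift `π'` of `π` to the successor variables: `s ↦ s`, `y_i ↦ y_{π i}`. [OURS · L1 W4.3] -/
def liftPerm : Equiv.Perm (Fin (m + 1)) where
  toFun := Fin.cases 0 fun i => (π i).succ
  invFun := Fin.cases 0 fun i => (π.symm i).succ
  left_inv j := by
    refine Fin.cases ?_ (fun i => ?_) j
    · rfl
    · simp
  right_inv j := by
    refine Fin.cases ?_ (fun i => ?_) j
    · rfl
    · simp

/-- `π'` fixes the exceptional slot. [OURS · L1 W4.3] -/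
theorem liftPerm_zero : liftPerm π 0 = 0 := rfl

/-- `π'` on the successors. [OURS · L1 W4.3] -/
theorem liftPerm_succ (i : Fin m) : liftPerm π i.succ = (π i).succ := rfl

/-- The inverse of the lift is the lift of the inverse. [OURS · L1 W4.3] -/
theorem liftPerm_symm : (liftPerm π).symm = liftPerm π.symm := rfl

end Lift

/-! ## §3 Relabelling a lattice -/

section Lattice

variable {m : ℕ} (π : Equiv.Perm (Fin m))

/-- RELABELLED LATTICE `L^π := {v : v ∘ π ∈ L}` (the characters of the relabelled coordinates). [OURS · L1 W4.3] -/
def permLattice (L : AddSubgroup (Fin m → ℤ)) : AddSubgroup (Fin m → ℤ) :=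
  L.comap (LinearMap.funLeft ℤ ℤ π).toAddMonoidHom

/-- Membership in the relabelled lattice. [OURS · L1 W4.3] -/
theorem mem_permLattice_iff (L : AddSubgroup (Fin m → ℤ)) (v : Fin m → ℤ) : v ∈ permLattice π L ↔ (fun i => v (π i)) ∈ L :=
  Iff.rfl

/-- Undoing a relabelling of a lattice. [OURS · L1 W4.3] -/
theorem permLattice_symm_permLattice (L : AddSubgroup (Fin m → ℤ)) : permLattice π.symm (permLattice π L) = L := by
  ext v
  rw [mem_permLattice_iff, mem_permLattice_iff]
  simp

end Lattice

/-! ## §4 Relabelled moves -/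

section Move

variable {m : ℕ} (π : Equiv.Perm (Fin m))

/-- The relabelled coordinate change `θ^π_j := (θ_{π⁻¹ j})^π`. [OURS · L1 W4.3] -/
noncomputable def relabelMove (θ : Fin m → MvPowerSeries (Fin m) k) : Fin m → MvPowerSeries (Fin m) k :=
  fun j => relabel π (θ (π.symm j))

/-- `θ^π ∘ π = relabel ∘ θ`. [OURS · L1 W4.3] -/
theorem relabelMove_apply_perm (θ : Fin m → MvPowerSeries (Fin m) k) (i : Fin m) :
    relabelMove π θ (π i) = relabel π (θ i) := by
  simp [relabelMove]

/-- Relabelled moves have zero constant terms. [OURS · L1 W4.3] -/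
theorem constantCoeff_relabelMove {θ : Fin m → MvPowerSeries (Fin m) k} (h0 : ∀ i, constantCoeff (θ i) = 0) (j : Fin m) :
    constantCoeff (relabelMove π θ j) = 0 := by
  rw [relabelMove, constantCoeff_relabel]; exact h0 _

/-- **`f^π(θ^π) = (f(θ))^π`**: substituting the relabelled move into the relabelled series relabels the substituted series.
[OURS · L1 W4.3] -/
theorem subst_relabelMove_relabel {θ : Fin m → MvPowerSeries (Fin m) k} (h0 : ∀ i, constantCoeff (θ i) = 0)
    (f : MvPowerSeries (Fin m) k) : subst (relabelMove π θ) (relabel π f) = relabel π (subst θ f) := by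
  have hθs : HasSubst θ := hasSubst_of_constantCoeff_zero h0
  have hθπs : HasSubst (relabelMove π θ) := hasSubst_of_constantCoeff_zero (constantCoeff_relabelMove π h0)
  unfold relabel
  rw [subst_comp_subst_apply (hasSubst_relabelFamily π) hθπs, subst_comp_subst_apply hθs (hasSubst_relabelFamily π)]
  congr 1
  funext i
  rw [subst_X hθπs]
  exact relabelMove_apply_perm π θ i

/-- The linear part of the relabelled move is the reindexed linear part. [OURS · L1 W4.3] -/
theorem linPart_relabelMove (θ : Fin m → MvPowerSeries (Fin m) k) :
    (Matrix.of fun a b => coeff (Finsupp.single b 1) (relabelMove π θ a)) =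
      (Matrix.of fun a b => coeff (Finsupp.single b 1) (θ a)).submatrix π.symm π.symm := by
  ext a b
  simp only [Matrix.of_apply, Matrix.submatrix_apply, relabelMove, coeff_single_relabel]

/-- **A GRADED MOVE RELABELS TO A GRADED MOVE** (lattice relabelled, weights relabelled). [OURS · L1 W4.3] -/
theorem isLGradedMove_relabel {L : AddSubgroup (Fin m → ℤ)} {θ : Fin m → MvPowerSeries (Fin m) k} {w : Fin m → ℕ}
    (h : IsLGradedMove L θ w) : IsLGradedMove (permLattice π L) (relabelMove π θ) (fun j => w (π.symm j)) := by
  obtain ⟨⟨h0, hdet, ⟨i, hi⟩⟩, hgr⟩ := h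
  refine ⟨⟨constantCoeff_relabelMove π h0, ?_, ⟨π i, by simpa using hi⟩⟩, ?_⟩
  · rw [linPart_relabelMove, Matrix.det_submatrix_equiv_self]; exact hdet
  · intro j e he
    rw [relabelMove, coeff_relabel] at he
    have hmem := hgr (π.symm j) _ he
    rw [mem_permLattice_iff]
    have hfun : (fun i => (expVec e - Pi.single j 1 : Fin m → ℤ) (π i)) = expVec (Finsupp.equivMapDomain π.symm e) - Pi.single (π.symm j) 1 := by
      funext i
      simp only [Pi.sub_apply, expVec, Finsupp.equivMapDomain_apply, Equiv.symm_symm]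
      congr 1
      by_cases hij : π i = j
      · subst hij; simp
      · rw [Pi.single_eq_of_ne hij, Pi.single_eq_of_ne]
        intro h'; exact hij (by rw [h']; simp)
    rw [hfun]
    exact hmem

end Move

/-! ## §5 Charts and successors under relabelling -/

section Chart

variable {m : ℕ} (π : Equiv.Perm (Fin m))

/-- Relabelling constants. [OURS · L1 W4.3] -/
theorem relabel_C (r : k) : relabel π (C r : MvPowerSeries (Fin m) k) = C r := by
  unfold relabel; rw [subst_C]

/-- **CHARTS COMMUTE WITH RELABELLING**: `chart^{w∘π⁻¹}_{c}(x_{π i}) = (chart^{w}_{c∘π}(x_i))^{π'}`. [OURS · L1 W4.3] -/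
theorem relabel_cruxChart (w : Fin m → ℕ) (c : Fin m → k) (i : Fin m) :
    CobordantGame.cruxChart k (fun j => w (π.symm j)) c (π i) =
      relabel (liftPerm π) (CobordantGame.cruxChart k w (fun j => c (π j)) i) := by
  have hS := hasSubst_relabelFamily (k := k) (liftPerm π)
  unfold CobordantGame.cruxChart relabel
  simp only [Equiv.symm_apply_apply]
  split_ifs with hw
  · rw [subst_mul hS, subst_pow hS, subst_add hS, subst_C, subst_X hS, subst_X hS, liftPerm_zero, liftPerm_succ]
  · rw [subst_X hS, liftPerm_succ]

/-- **THE CHART OF A RELABELLED POSITION IS THE RELABELLED CHART.** [OURS · L1 W4.3] -/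
theorem subst_cruxChart_relabel (w : Fin m → ℕ) (c : Fin m → k) (F : MvPowerSeries (Fin m) k) :
    subst (CobordantGame.cruxChart k (fun j => w (π.symm j)) c) (relabel π F) =
      relabel (liftPerm π) (subst (CobordantGame.cruxChart k w (fun j => c (π j))) F) := by
  have hC := hasSubst_cruxChart (k := k) (fun j => w (π.symm j)) c
  have hC' := hasSubst_cruxChart (k := k) w (fun j => c (π j))
  unfold relabel
  rw [subst_comp_subst_apply (hasSubst_relabelFamily π) hC, subst_comp_subst_apply hC' (hasSubst_relabelFamily (liftPerm π))]
  congr 1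
  funext i
  rw [subst_X hC]
  exact relabel_cruxChart π w c i

/-- **SUCCESSORS TRANSPORT UNDER RELABELLING**: a successor of the relabelled position `f^π` under the relabelled move at `c` is the
relabelling (by `π'`) of a successor of `f` under the original move at `c ∘ π`, same exponent. [OURS · L1 W4.3] -/
theorem isSuccessorAt_of_relabel {θ : Fin m → MvPowerSeries (Fin m) k} (h0 : ∀ i, constantCoeff (θ i) = 0) (w : Fin m → ℕ)
    (f : MvPowerSeries (Fin m) k) (c : Fin m → k) (a : ℕ) (g' : MvPowerSeries (Fin (m + 1)) k)
    (hg : IsSuccessorAt (relabel π f) (relabelMove π θ) (fun j => w (π.symm j)) c a g') :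
    IsSuccessorAt f θ w (fun j => c (π j)) a (relabel (liftPerm π).symm g') := by
  obtain ⟨⟨i, hwi, hci⟩, hfac, hndvd, hsing⟩ := hg
  refine ⟨⟨π.symm i, hwi, by simpa using hci⟩, ?_, ?_, ?_⟩
  · rw [subst_relabelMove_relabel π h0, subst_cruxChart_relabel] at hfac
    have h := congrArg (relabel (liftPerm π).symm) hfac
    rw [relabel_symm_relabel] at h
    rw [h]
    unfold relabel
    rw [subst_mul (hasSubst_relabelFamily _), subst_pow (hasSubst_relabelFamily _), subst_X (hasSubst_relabelFamily _)]
    rw [liftPerm_symm, liftPerm_zero]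
  · rw [X_dvd_relabel_iff _ (by rw [liftPerm_symm, liftPerm_zero])]; exact hndvd
  · rw [singular_relabel_iff]; exact hsing

end Chart

/-! ## §6 The propagated lattice of a relabelled move -/

section SuccLattice

variable {m : ℕ} (π : Equiv.Perm (Fin m))

/-- One inclusion: the propagated lattice of the relabelled data sits inside the relabelled propagated lattice. [OURS · L1 W4.3] -/
theorem succLattice_le_permLattice (L : AddSubgroup (Fin m → ℤ)) (w : Fin m → ℕ) (c : Fin m → k) :
    succLattice (permLattice π L) (fun j => w (π.symm j)) c ≤ permLattice (liftPerm π) (succLattice L w (fun j => c (π j))) := by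
  unfold succLattice
  rw [AddSubgroup.closure_le]
  rintro u (⟨r, hr, rfl⟩ | ⟨j, hcj, hwj, rfl⟩)
  · rw [SetLike.mem_coe, mem_permLattice_iff]
    rw [mem_permLattice_iff] at hr
    refine AddSubgroup.subset_closure (Or.inl ⟨fun i => r (π i), hr, ?_⟩)
    funext l
    refine Fin.cases ?_ (fun i => ?_) l
    · rw [liftPerm_zero, Matrix.cons_val_zero, Matrix.cons_val_zero]
      exact (Equiv.sum_comp π (fun j => (w (π.symm j) : ℤ) * r j)).symm.trans (Finset.sum_congr rfl fun i _ => by simp)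
    · rw [liftPerm_succ, Matrix.cons_val_succ, Matrix.cons_val_succ]
  · rw [SetLike.mem_coe, mem_permLattice_iff]
    refine AddSubgroup.subset_closure (Or.inr ⟨π.symm j, by simpa using hcj, hwj, ?_⟩)
    funext l
    refine Fin.cases ?_ (fun i => ?_) l
    · rw [liftPerm_zero, Pi.single_eq_of_ne (Fin.succ_ne_zero _).symm, Pi.single_eq_of_ne (Fin.succ_ne_zero _).symm]
    · rw [liftPerm_succ]
      by_cases hi : π i = j
      · subst hi; simp
      · rw [Pi.single_eq_of_ne (fun h => hi (Fin.succ_injective _ h)), Pi.single_eq_of_ne]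
        intro h
        exact hi (by rw [Fin.succ_injective _ h]; simp)

/-- **THE PROPAGATED LATTICE OF THE RELABELLED MOVE IS THE RELABELLED PROPAGATED LATTICE.** [OURS · L1 W4.3] -/
theorem succLattice_permLattice (L : AddSubgroup (Fin m → ℤ)) (w : Fin m → ℕ) (c : Fin m → k) :
    succLattice (permLattice π L) (fun j => w (π.symm j)) c = permLattice (liftPerm π) (succLattice L w (fun j => c (π j))) := by
  refine le_antisymm (succLattice_le_permLattice π L w c) ?_
  intro v hv
  rw [mem_permLattice_iff] at hv
  -- apply the inclusion for `π⁻¹` to the data `(L^π, w ∘ π⁻¹, c ∘ π)`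
  have h := succLattice_le_permLattice π.symm (permLattice π L) (fun j => w (π.symm j)) (fun j => c (π j))
  rw [permLattice_symm_permLattice] at h
  have hw : (fun j => (fun j => w (π.symm j)) (π.symm.symm j)) = w := by funext j; simp
  have hc : (fun j => (fun j => c (π j)) (π.symm j)) = c := by funext j; simp
  rw [hw, hc] at h
  have hv' := h hv
  rw [mem_permLattice_iff] at hv'
  have hvv : (fun i => (fun i => v (liftPerm π i)) (liftPerm π.symm i)) = v := by
    funext i; simp only; rw [← liftPerm_symm, Equiv.apply_symm_apply]
  rwa [hvv] at hv'

end SuccLattice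

/-! ## §7 Equivariance of the graded game -/

/-- **GRADED WINS RELABEL** (one direction; transfinite induction on the rank). [OURS · L1 W4.3] -/
theorem gradedWonBy_relabel (α : Ordinal.{0}) :
    ∀ {m : ℕ} (π : Equiv.Perm (Fin m)) (L : AddSubgroup (Fin m → ℤ)) (f : MvPowerSeries (Fin m) k),
      GradedWonBy α m L f → GradedWonBy α m (permLattice π L) (relabel π f) := by
  induction α using WellFoundedLT.induction with
  | ind α ih =>
    intro m π L f h
    rw [gradedWonBy_iff] at h ⊢
    obtain ⟨θ, w, hθ, hs⟩ := h
    refine ⟨relabelMove π θ, fun j => w (π.symm j), isLGradedMove_relabel π hθ, fun c a g' hg' => ?_⟩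
    have hg := isSuccessorAt_of_relabel π hθ.1.1 w f c a g' hg'
    obtain ⟨β, hβ, hW⟩ := hs _ a _ hg
    refine ⟨β, hβ, ?_⟩
    have h2 := ih β hβ (liftPerm π) _ _ hW
    rw [relabel_relabel_symm, ← succLattice_permLattice] at h2
    exact h2

/-- **THE GRADED GAME IS EQUIVARIANT UNDER RELABELLING OF THE COORDINATES**: `GradedWonBy α m L^π f^π ↔ GradedWonBy α m L f`.
(So the slice theorems of the line, stated with the frozen coordinate last, apply at any coordinate.) [OURS · L1 W4.3] -/
theorem gradedWonBy_relabel_iff (α : Ordinal.{0}) {m : ℕ} (π : Equiv.Perm (Fin m)) (L : AddSubgroup (Fin m → ℤ))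
    (f : MvPowerSeries (Fin m) k) : GradedWonBy α m (permLattice π L) (relabel π f) ↔ GradedWonBy α m L f := by
  refine ⟨fun h => ?_, gradedWonBy_relabel α π L f⟩
  have h2 := gradedWonBy_relabel α π.symm _ _ h
  rwa [permLattice_symm_permLattice, relabel_symm_relabel] at h2

end GradedGame

end Summit.ResolutionOfSingularities.ResolutionOfSingularities.Theorems
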